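import Literature.Probability.NegativeDependence.NegativeAssociationHierarchy
import Literature.Combinatorics.SimpleGraph.ChromaticPolynomialForests
import HarnessLib

/-!
# The random cluster model with `p = 1/2`: the multivariate Tutte polynomial `Z_G(z,q) = Σ_F q^{k(F)} z^F`;
# on a forest `Z_G = q^{|V|−|E|} Π_e (q + z_e)` is strongly Rayleigh (Borcea–Brändén–Liggett §3.4)

J. Borcea, P. Brändén, T. M. Liggett, *Negative dependence and the geometry of polynomials*, J. Amer. Math. Soc.
22 (2009) 521–567 (arXiv:0707.2340, held `paper:arxiv-0707.2340`, arXiv numbering), §3.4 (arXiv p. 13),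
verbatim:

> Let `G = (V,E)` be a graph and let `q > 0` and `0 ≤ p ≤ 1` be parameters. The random cluster (RC) model, see
> [Grimmett], is the measure `μ` on `2^E` defined by `μ(F) = Z_RC^{−1} q^{k(F)} p^{|F|} (1−p)^{|E∖F|}`, `F ⊆ E`,
> where `k(F)` is the number of connected components in the graph `(V,F)` and `Z_RC` is the appropriate
> normalizing factor. […] We are interested in properties closed under external fields so we assume that
> `p = 1/2`. The generating polynomial of `μ` is then a constant multiple of the multivariate Tutte polynomial
> (see [Sokal]): `Z_G(z,q) = Σ_{F ⊆ E} q^{k(F)} z^F`, `z = (z_e)_{e∈E}`. […] If `G` is a tree, then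
> `Z_G(z,q) = q Π_{e∈E} (q + z_e)`, so the RC model is strongly Rayleigh.

## What is here (vocabulary of the tree's `ChromaticPolynomial.numComponents` — «k(F)» — and `StableOrZero`)

* §1 **`rcWeight G q`** (the `p = 1/2` random cluster weight `F ↦ q^{k(F)}` on `2^{E(G)}`, unnormalised; its
  generating polynomial `multiAffine (rcWeight G q)` is the multivariate Tutte polynomial `Z_G(z,q)`),
  `rcWeight_nonneg`, `rcWeight_of_isAcyclic` (`= q^{|V|−|F|}` on a forest `G`, by the tree's
  `ChromaticPolynomial.numComponents_add_card_of_isAcyclic`: `k(F) + |F| = |V|`).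
* §2 **`multiAffine_rcWeight_of_isAcyclic`** («if G is a tree then Z_G(z,q) = q Π_e (q + z_e)»; for forests
  `q^{|V|−|E|} Π_e (z_e + q)`), `multiAffine_rcWeight_of_isTree` (the printed tree case),
  **`stableOrZero_rcWeight_of_isAcyclic`** («so the RC model is strongly Rayleigh», `q > 0`),
  `isCNAPlus_rcWeight_of_isAcyclic`.

Not formalised here: the cycle computation `Z_{C_n}` («Rayleigh but not strongly Rayleigh») and the NLC/PLC
remarks for general `G` (stated in BBL without proof).  No `sorry`, no named fact, no instance/notation.

## References

* [BorceaBrandenLiggett2007] — §3.4 (random cluster model, multivariate Tutte polynomial, tree case).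
-/

noncomputable section

open Finset MvPolynomial
open Literature.Combinatorics.StablePolynomials
open Literature.Combinatorics.SimpleGraph.ChromaticPolynomial

namespace Literature.Probability.NegativeDependence

variable {V : Type*} [Fintype V] [DecidableEq V] (G : SimpleGraph V) [DecidableRel G.Adj]

/-! ## §1 The random cluster weight with `p = 1/2` (`k(F)` = the tree's `numComponents`) -/

section Weight

/-- **The random cluster weight** (`p = 1/2`, unnormalised): `F ↦ q^{k(F)}` on the subsets `F ⊆ E(G)` (and `0`
on sets of non-edges); its generating polynomial `multiAffine (rcWeight G q)` is the multivariate Tutte polynomial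
`Z_G(z,q) = Σ_{F ⊆ E} q^{k(F)} z^F`. [cite: BorceaBrandenLiggett2007, §3.4 («μ(F) = Z_RC^{−1} q^{k(F)} p^{|F|}
(1−p)^{|E∖F|}» with p = 1/2; «Z_G(z,q) = Σ_{F⊆E} q^{k(F)} z^F»)] -/
def rcWeight (q : ℝ) : Finset (Sym2 V) → ℝ :=
  fun A => if A ⊆ G.edgeFinset then q ^ numComponents A else 0

/-- Unfolding `rcWeight`. [cite: BorceaBrandenLiggett2007, §3.4] -/
theorem rcWeight_apply (q : ℝ) (A : Finset (Sym2 V)) :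
    rcWeight G q A = if A ⊆ G.edgeFinset then q ^ numComponents A else 0 := rfl

/-- `rcWeight G q ≥ 0` for `q ≥ 0`. [cite: BorceaBrandenLiggett2007, §3.4 (q > 0)] -/
theorem rcWeight_nonneg {q : ℝ} (hq : 0 ≤ q) (A : Finset (Sym2 V)) : 0 ≤ rcWeight G q A := by
  rw [rcWeight_apply]
  split_ifs
  · exact pow_nonneg hq _
  · exact le_rfl

/-- On a forest `G`: `q^{k(F)} = q^{|V| − |F|}` for `F ⊆ E(G)`. [cite: BorceaBrandenLiggett2007, §3.4 («if G is
a tree …»)] -/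
theorem rcWeight_of_isAcyclic (hG : G.IsAcyclic) (q : ℝ) {A : Finset (Sym2 V)} (hA : A ⊆ G.edgeFinset) :
    rcWeight G q A = q ^ (Fintype.card V - A.card) := by
  rw [rcWeight_apply, if_pos hA, ← numComponents_add_card_of_isAcyclic G hG hA, Nat.add_sub_cancel]

end Weight

/-! ## §2 Forests: `Z_G(z,q) = q^{|V|−|E|} Π_e (q + z_e)` is strongly Rayleigh -/

section Forest

/-- **«If `G` is a tree, then `Z_G(z,q) = q Π_{e∈E} (q + z_e)`»** — for a forest `G` (acyclic),
`Z_G(z,q) = q^{|V|−|E|} Π_{e ∈ E} (q + z_e)`. [cite: BorceaBrandenLiggett2007, §3.4] -/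
theorem multiAffine_rcWeight_of_isAcyclic (hG : G.IsAcyclic) (q : ℝ) :
    multiAffine (rcWeight G q) =
      C (q ^ (Fintype.card V - G.edgeFinset.card)) * ∏ e ∈ G.edgeFinset, (X e + C q) := by
  have hE : G.edgeFinset.card ≤ Fintype.card V := by
    have h := numComponents_add_card_of_isAcyclic G hG (Subset.refl G.edgeFinset)
    omega
  rw [multiAffine, prod_add, mul_sum]
  -- keep only the subsets of `E(G)`
  rw [← sum_subset (subset_univ G.edgeFinset.powerset)]
  · refine sum_congr rfl fun A hA => ?_
    rw [mem_powerset] at hA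
    have hAc : A.card ≤ G.edgeFinset.card := card_le_card hA
    rw [rcWeight_of_isAcyclic G hG q hA,
      show Fintype.card V - A.card = (Fintype.card V - G.edgeFinset.card) + (G.edgeFinset.card - A.card) by omega,
      pow_add, map_mul, prod_const, card_sdiff_of_subset hA]
    simp only [map_pow]
    ring
  · intro A _ hA
    rw [mem_powerset] at hA
    rw [rcWeight_apply, if_neg hA, C_0, zero_mul]

/-- The printed tree case: for a tree `G`, `Z_G(z,q) = q Π_{e∈E} (q + z_e)` (`|E| = |V| − 1`).
[cite: BorceaBrandenLiggett2007, §3.4 («If G is a tree, then Z_G(z,q) = q Π_{e∈E}(q+z_e)»)] -/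
theorem multiAffine_rcWeight_of_isTree (hG : G.IsTree) (q : ℝ) :
    multiAffine (rcWeight G q) = C q * ∏ e ∈ G.edgeFinset, (X e + C q) := by
  rw [multiAffine_rcWeight_of_isAcyclic G hG.isAcyclic, ← hG.card_edgeFinset, Nat.add_sub_cancel_left, pow_one]

/-- **«so the RC model is strongly Rayleigh»** on a forest (`q > 0`): `q^{|V|−|E|} Π_e (q + z_e)` has no zero
in the open upper half-space. [cite: BorceaBrandenLiggett2007, §3.4] -/
theorem stableOrZero_rcWeight_of_isAcyclic (hG : G.IsAcyclic) {q : ℝ} (hq : 0 < q) :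
    StableOrZero (rcWeight G q) := by
  rw [stableOrZero_iff]
  refine Or.inr ((isRealStable_iff _).2 fun z hz => ?_)
  rw [multiAffine_rcWeight_of_isAcyclic G hG q, eval₂_mul, eval₂_C, eval₂_prod]
  refine mul_ne_zero ?_ (prod_ne_zero_iff.2 fun e _ => ?_)
  · exact (map_ne_zero_iff _ (algebraMap ℝ ℂ).injective).2 (pow_pos hq _).ne'
  · rw [eval₂_add, eval₂_C, eval₂_X]
    intro h
    have him := congrArg Complex.im h
    rw [Complex.add_im, Complex.zero_im] at him
    have : ((algebraMap ℝ ℂ) q).im = 0 := Complex.ofReal_im q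
    linarith [hz e]

/-- The random cluster measure on a forest is CNA+ (strongly Rayleigh ⟹ CNA+, Thm. 4.9).
[cite: BorceaBrandenLiggett2007, §3.4 with §4.2 Thm. 4.9] -/
theorem isCNAPlus_rcWeight_of_isAcyclic (hG : G.IsAcyclic) {q : ℝ} (hq : 0 < q) : IsCNAPlus (rcWeight G q) :=
  (stableOrZero_rcWeight_of_isAcyclic G hG hq).isCNAPlus (rcWeight_nonneg G hq.le)

end Forest

end Literature.Probability.NegativeDependence
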